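/-
Copyright: the b2b-balaban T⁴-continuum CRUX team, row NE7b OWNER lineage `t4-ne7b-p1` (gen 144). Project licence.
-/
import Mathlib.MeasureTheory.Integral.Bochner.Basic

/-!
# GLUE FOR THE ORDER-FIVE KERNEL LETTER, I — REINDEXINGS AND `|·|`-SPLITS (SCOPING (d15′)(vi), first file): the fifty-two placements of
# the fifth derivative's display ((591)–(594): the five groups of (521)'s centred order-4 display differentiated along `n = e_x`) are
# bounded, row by row, by the piece files (558)–(580) — each stated in ONE fixed slot pattern with the row index `x` in the FIRST factor.
# A placement differs from its piece by a permutation of the four summed indices `(y,z,t,s)` — §1, sixteen reindexing identities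
# `Σf∘π = Σf` ((522)'s `sum3_*` one index up) — and by the position of the factor carrying `x` (next file).  §2: the `|·|`-splits of the
# five group values (2, 12, 9, 12 + 12, 5 terms) and of the assembled derivative `G₁′ − G₂′ − G₃′ + (G₄′ + G₄″) − G₅′`; §3: the same splits
# SUMMED over the row with the sums distributed (used by unification: no `simp` traverses the display) (row NE7b, node U5c; Mathlib only;
# [folklore])

Cell `pub-balaban`, sub-cell `t4`, spine estimate NE7b (`T4WeightBudget.RelWeightBound`; the cell's OWN estimate — NOT PRINTED in
[Bałaban 1983–89], NOT PROVED).  Crux-route work under `Spine/NE7b/` by the row OWNER (`t4-ne7b-p1` gen 144, file (595)) under FREEZE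
(0)'s crux-prover clause; NOTHING of Bałaban's is named as a Lean object, valued or asserted; no `T4Continuum/Support` leaf typed; no
`def`, no notation; zero `sorry`.  Imports: Mathlib only.

WHAT IS PROVED ([folklore]):
* §1 `sum4_ytsz`, `sum4_zyts`, `sum4_yzst`, `sum4_tyzs`, `sum4_syzt`, `sum4_ztsy`, `sum4_tsyz`, `sum4_ytzs`, `sum4_zsyt`, `sum4_yszt`,
  `sum4_ztys`, `sum4_sytz`, `sum4_zyst`, `sum4_tysz`, `sum4_szty`, `sum4_tzsy`;
* §2 `abs_split_cov4`, `abs_split_cov3`, `abs_split_kappa3`, `abs_split_u4`, `abs_split_fifth`;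
* §3 `sum4_abs_split_mean`, `sum4_abs_split_cov4`, `sum4_abs_split_cov3`, `sum4_abs_split_kappa3`, `sum4_abs_split_u4`, `sum4_abs_split_fifth`;
  §4 toy.

HONEST (what this is NOT).  Pure bookkeeping (finite sums, the triangle inequality): NOT a bound on anything; the group row letters and the
order-5 kernel letter are the files after next.  Scalar skeleton ((A3), NC-NE7b-α UNRULED); nothing of Bałaban's
asserted.  BY-NAME EFFECT ON THE WALL: NONE.  NE7b NOT PRINTED ∕ NOT PROVED; spine PROVED 0∕9; rung (B)+1 — the programme's measures remain
FINITE-torus statements; NOT the mass gap, NOT Clay.  HONEST DEPENDENCY: continuum YM on T⁴ ⇐ BetaPertH ∧ nine spine estimates (0∕9 proved);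
BetaPertH ⇐ (D1) ∧ (D4) ∧ CAP+tail; G-an2-4 gates asym, D1 and NE2∕3∕4.
-/

set_option autoImplicit false

noncomputable section

namespace Summit.QuantumFields.BalabanUV.T4Continuum.NE7b.SupFifthKernelSums

open MeasureTheory Finset
open scoped BigOperators

variable {ι : Type} [Fintype ι] [DecidableEq ι]

/-! ## §1. Reindexings of quadruple site sums -/

omit [DecidableEq ι] in
/-- `Σ_yΣ_zΣ_tΣ_s f(y,t,s,z) = Σ_yΣ_zΣ_tΣ_s f(y,z,t,s)` (reindexing of a quadruple site sum). [folklore] -/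
theorem sum4_ytsz (f : ι → ι → ι → ι → ℝ) : ∑ y, ∑ z, ∑ t, ∑ s, f y t s z = ∑ y, ∑ z, ∑ t, ∑ s, f y z t s := by
  have h1 : ∑ y, ∑ z, ∑ t, ∑ s, f y t s z = ∑ y, ∑ z, ∑ t, ∑ s, f y z s t := Finset.sum_congr rfl fun _ _ => Finset.sum_comm
  have h2 : ∑ y, ∑ z, ∑ t, ∑ s, f y z s t = ∑ y, ∑ z, ∑ t, ∑ s, f y z t s := Finset.sum_congr rfl fun _ _ => Finset.sum_congr rfl fun _ _ =>
      Finset.sum_comm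
  rw [h1, h2]

omit [DecidableEq ι] in
/-- `Σ_yΣ_zΣ_tΣ_s f(z,y,t,s) = Σ_yΣ_zΣ_tΣ_s f(y,z,t,s)` (reindexing of a quadruple site sum). [folklore] -/
theorem sum4_zyts (f : ι → ι → ι → ι → ℝ) : ∑ y, ∑ z, ∑ t, ∑ s, f z y t s = ∑ y, ∑ z, ∑ t, ∑ s, f y z t s := Finset.sum_comm

omit [DecidableEq ι] in
/-- `Σ_yΣ_zΣ_tΣ_s f(y,z,s,t) = Σ_yΣ_zΣ_tΣ_s f(y,z,t,s)` (reindexing of a quadruple site sum). [folklore] -/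
theorem sum4_yzst (f : ι → ι → ι → ι → ℝ) : ∑ y, ∑ z, ∑ t, ∑ s, f y z s t = ∑ y, ∑ z, ∑ t, ∑ s, f y z t s :=
  Finset.sum_congr rfl fun _ _ => Finset.sum_congr rfl fun _ _ => Finset.sum_comm

omit [DecidableEq ι] in
/-- `Σ_yΣ_zΣ_tΣ_s f(t,y,z,s) = Σ_yΣ_zΣ_tΣ_s f(y,z,t,s)` (reindexing of a quadruple site sum). [folklore] -/
theorem sum4_tyzs (f : ι → ι → ι → ι → ℝ) : ∑ y, ∑ z, ∑ t, ∑ s, f t y z s = ∑ y, ∑ z, ∑ t, ∑ s, f y z t s := by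
  have h1 : ∑ y, ∑ z, ∑ t, ∑ s, f t y z s = ∑ y, ∑ z, ∑ t, ∑ s, f z y t s := Finset.sum_congr rfl fun _ _ => Finset.sum_comm
  have h2 : ∑ y, ∑ z, ∑ t, ∑ s, f z y t s = ∑ y, ∑ z, ∑ t, ∑ s, f y z t s := Finset.sum_comm
  rw [h1, h2]

omit [DecidableEq ι] in
/-- `Σ_yΣ_zΣ_tΣ_s f(s,y,z,t) = Σ_yΣ_zΣ_tΣ_s f(y,z,t,s)` (reindexing of a quadruple site sum). [folklore] -/
theorem sum4_syzt (f : ι → ι → ι → ι → ℝ) : ∑ y, ∑ z, ∑ t, ∑ s, f s y z t = ∑ y, ∑ z, ∑ t, ∑ s, f y z t s := by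
  have h1 : ∑ y, ∑ z, ∑ t, ∑ s, f s y z t = ∑ y, ∑ z, ∑ t, ∑ s, f t y z s := Finset.sum_congr rfl fun _ _ => Finset.sum_congr rfl fun _ _ =>
      Finset.sum_comm
  have h2 : ∑ y, ∑ z, ∑ t, ∑ s, f t y z s = ∑ y, ∑ z, ∑ t, ∑ s, f z y t s := Finset.sum_congr rfl fun _ _ => Finset.sum_comm
  have h3 : ∑ y, ∑ z, ∑ t, ∑ s, f z y t s = ∑ y, ∑ z, ∑ t, ∑ s, f y z t s := Finset.sum_comm
  rw [h1, h2, h3]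

omit [DecidableEq ι] in
/-- `Σ_yΣ_zΣ_tΣ_s f(z,t,s,y) = Σ_yΣ_zΣ_tΣ_s f(y,z,t,s)` (reindexing of a quadruple site sum). [folklore] -/
theorem sum4_ztsy (f : ι → ι → ι → ι → ℝ) : ∑ y, ∑ z, ∑ t, ∑ s, f z t s y = ∑ y, ∑ z, ∑ t, ∑ s, f y z t s := by
  have h1 : ∑ y, ∑ z, ∑ t, ∑ s, f z t s y = ∑ y, ∑ z, ∑ t, ∑ s, f y t s z := Finset.sum_comm
  have h2 : ∑ y, ∑ z, ∑ t, ∑ s, f y t s z = ∑ y, ∑ z, ∑ t, ∑ s, f y z s t := Finset.sum_congr rfl fun _ _ => Finset.sum_comm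
  have h3 : ∑ y, ∑ z, ∑ t, ∑ s, f y z s t = ∑ y, ∑ z, ∑ t, ∑ s, f y z t s := Finset.sum_congr rfl fun _ _ => Finset.sum_congr rfl fun _ _ =>
      Finset.sum_comm
  rw [h1, h2, h3]

omit [DecidableEq ι] in
/-- `Σ_yΣ_zΣ_tΣ_s f(t,s,y,z) = Σ_yΣ_zΣ_tΣ_s f(y,z,t,s)` (reindexing of a quadruple site sum). [folklore] -/
theorem sum4_tsyz (f : ι → ι → ι → ι → ℝ) : ∑ y, ∑ z, ∑ t, ∑ s, f t s y z = ∑ y, ∑ z, ∑ t, ∑ s, f y z t s := by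
  have h1 : ∑ y, ∑ z, ∑ t, ∑ s, f t s y z = ∑ y, ∑ z, ∑ t, ∑ s, f z s y t := Finset.sum_congr rfl fun _ _ => Finset.sum_comm
  have h2 : ∑ y, ∑ z, ∑ t, ∑ s, f z s y t = ∑ y, ∑ z, ∑ t, ∑ s, f y s z t := Finset.sum_comm
  have h3 : ∑ y, ∑ z, ∑ t, ∑ s, f y s z t = ∑ y, ∑ z, ∑ t, ∑ s, f y t z s := Finset.sum_congr rfl fun _ _ => Finset.sum_congr rfl fun _ _ =>
      Finset.sum_comm
  have h4 : ∑ y, ∑ z, ∑ t, ∑ s, f y t z s = ∑ y, ∑ z, ∑ t, ∑ s, f y z t s := Finset.sum_congr rfl fun _ _ => Finset.sum_comm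
  rw [h1, h2, h3, h4]

omit [DecidableEq ι] in
/-- `Σ_yΣ_zΣ_tΣ_s f(y,t,z,s) = Σ_yΣ_zΣ_tΣ_s f(y,z,t,s)` (reindexing of a quadruple site sum). [folklore] -/
theorem sum4_ytzs (f : ι → ι → ι → ι → ℝ) : ∑ y, ∑ z, ∑ t, ∑ s, f y t z s = ∑ y, ∑ z, ∑ t, ∑ s, f y z t s :=
  Finset.sum_congr rfl fun _ _ => Finset.sum_comm

omit [DecidableEq ι] in
/-- `Σ_yΣ_zΣ_tΣ_s f(z,s,y,t) = Σ_yΣ_zΣ_tΣ_s f(y,z,t,s)` (reindexing of a quadruple site sum). [folklore] -/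
theorem sum4_zsyt (f : ι → ι → ι → ι → ℝ) : ∑ y, ∑ z, ∑ t, ∑ s, f z s y t = ∑ y, ∑ z, ∑ t, ∑ s, f y z t s := by
  have h1 : ∑ y, ∑ z, ∑ t, ∑ s, f z s y t = ∑ y, ∑ z, ∑ t, ∑ s, f y s z t := Finset.sum_comm
  have h2 : ∑ y, ∑ z, ∑ t, ∑ s, f y s z t = ∑ y, ∑ z, ∑ t, ∑ s, f y t z s := Finset.sum_congr rfl fun _ _ => Finset.sum_congr rfl fun _ _ =>
      Finset.sum_comm
  have h3 : ∑ y, ∑ z, ∑ t, ∑ s, f y t z s = ∑ y, ∑ z, ∑ t, ∑ s, f y z t s := Finset.sum_congr rfl fun _ _ => Finset.sum_comm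
  rw [h1, h2, h3]

omit [DecidableEq ι] in
/-- `Σ_yΣ_zΣ_tΣ_s f(y,s,z,t) = Σ_yΣ_zΣ_tΣ_s f(y,z,t,s)` (reindexing of a quadruple site sum). [folklore] -/
theorem sum4_yszt (f : ι → ι → ι → ι → ℝ) : ∑ y, ∑ z, ∑ t, ∑ s, f y s z t = ∑ y, ∑ z, ∑ t, ∑ s, f y z t s := by
  have h1 : ∑ y, ∑ z, ∑ t, ∑ s, f y s z t = ∑ y, ∑ z, ∑ t, ∑ s, f y t z s := Finset.sum_congr rfl fun _ _ => Finset.sum_congr rfl fun _ _ =>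
      Finset.sum_comm
  have h2 : ∑ y, ∑ z, ∑ t, ∑ s, f y t z s = ∑ y, ∑ z, ∑ t, ∑ s, f y z t s := Finset.sum_congr rfl fun _ _ => Finset.sum_comm
  rw [h1, h2]

omit [DecidableEq ι] in
/-- `Σ_yΣ_zΣ_tΣ_s f(z,t,y,s) = Σ_yΣ_zΣ_tΣ_s f(y,z,t,s)` (reindexing of a quadruple site sum). [folklore] -/
theorem sum4_ztys (f : ι → ι → ι → ι → ℝ) : ∑ y, ∑ z, ∑ t, ∑ s, f z t y s = ∑ y, ∑ z, ∑ t, ∑ s, f y z t s := by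
  have h1 : ∑ y, ∑ z, ∑ t, ∑ s, f z t y s = ∑ y, ∑ z, ∑ t, ∑ s, f y t z s := Finset.sum_comm
  have h2 : ∑ y, ∑ z, ∑ t, ∑ s, f y t z s = ∑ y, ∑ z, ∑ t, ∑ s, f y z t s := Finset.sum_congr rfl fun _ _ => Finset.sum_comm
  rw [h1, h2]

omit [DecidableEq ι] in
/-- `Σ_yΣ_zΣ_tΣ_s f(s,y,t,z) = Σ_yΣ_zΣ_tΣ_s f(y,z,t,s)` (reindexing of a quadruple site sum). [folklore] -/
theorem sum4_sytz (f : ι → ι → ι → ι → ℝ) : ∑ y, ∑ z, ∑ t, ∑ s, f s y t z = ∑ y, ∑ z, ∑ t, ∑ s, f y z t s := by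
  have h1 : ∑ y, ∑ z, ∑ t, ∑ s, f s y t z = ∑ y, ∑ z, ∑ t, ∑ s, f s y z t := Finset.sum_congr rfl fun _ _ => Finset.sum_comm
  have h2 : ∑ y, ∑ z, ∑ t, ∑ s, f s y z t = ∑ y, ∑ z, ∑ t, ∑ s, f t y z s := Finset.sum_congr rfl fun _ _ => Finset.sum_congr rfl fun _ _ =>
      Finset.sum_comm
  have h3 : ∑ y, ∑ z, ∑ t, ∑ s, f t y z s = ∑ y, ∑ z, ∑ t, ∑ s, f z y t s := Finset.sum_congr rfl fun _ _ => Finset.sum_comm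
  have h4 : ∑ y, ∑ z, ∑ t, ∑ s, f z y t s = ∑ y, ∑ z, ∑ t, ∑ s, f y z t s := Finset.sum_comm
  rw [h1, h2, h3, h4]

omit [DecidableEq ι] in
/-- `Σ_yΣ_zΣ_tΣ_s f(z,y,s,t) = Σ_yΣ_zΣ_tΣ_s f(y,z,t,s)` (reindexing of a quadruple site sum). [folklore] -/
theorem sum4_zyst (f : ι → ι → ι → ι → ℝ) : ∑ y, ∑ z, ∑ t, ∑ s, f z y s t = ∑ y, ∑ z, ∑ t, ∑ s, f y z t s := by
  have h1 : ∑ y, ∑ z, ∑ t, ∑ s, f z y s t = ∑ y, ∑ z, ∑ t, ∑ s, f y z s t := Finset.sum_comm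
  have h2 : ∑ y, ∑ z, ∑ t, ∑ s, f y z s t = ∑ y, ∑ z, ∑ t, ∑ s, f y z t s := Finset.sum_congr rfl fun _ _ => Finset.sum_congr rfl fun _ _ =>
      Finset.sum_comm
  rw [h1, h2]

omit [DecidableEq ι] in
/-- `Σ_yΣ_zΣ_tΣ_s f(t,y,s,z) = Σ_yΣ_zΣ_tΣ_s f(y,z,t,s)` (reindexing of a quadruple site sum). [folklore] -/
theorem sum4_tysz (f : ι → ι → ι → ι → ℝ) : ∑ y, ∑ z, ∑ t, ∑ s, f t y s z = ∑ y, ∑ z, ∑ t, ∑ s, f y z t s := by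
  have h1 : ∑ y, ∑ z, ∑ t, ∑ s, f t y s z = ∑ y, ∑ z, ∑ t, ∑ s, f z y s t := Finset.sum_congr rfl fun _ _ => Finset.sum_comm
  have h2 : ∑ y, ∑ z, ∑ t, ∑ s, f z y s t = ∑ y, ∑ z, ∑ t, ∑ s, f y z s t := Finset.sum_comm
  have h3 : ∑ y, ∑ z, ∑ t, ∑ s, f y z s t = ∑ y, ∑ z, ∑ t, ∑ s, f y z t s := Finset.sum_congr rfl fun _ _ => Finset.sum_congr rfl fun _ _ =>
      Finset.sum_comm
  rw [h1, h2, h3]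

omit [DecidableEq ι] in
/-- `Σ_yΣ_zΣ_tΣ_s f(s,z,t,y) = Σ_yΣ_zΣ_tΣ_s f(y,z,t,s)` (reindexing of a quadruple site sum). [folklore] -/
theorem sum4_szty (f : ι → ι → ι → ι → ℝ) : ∑ y, ∑ z, ∑ t, ∑ s, f s z t y = ∑ y, ∑ z, ∑ t, ∑ s, f y z t s := by
  have h1 : ∑ y, ∑ z, ∑ t, ∑ s, f s z t y = ∑ y, ∑ z, ∑ t, ∑ s, f s y t z := Finset.sum_comm
  have h2 : ∑ y, ∑ z, ∑ t, ∑ s, f s y t z = ∑ y, ∑ z, ∑ t, ∑ s, f s y z t := Finset.sum_congr rfl fun _ _ => Finset.sum_comm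
  have h3 : ∑ y, ∑ z, ∑ t, ∑ s, f s y z t = ∑ y, ∑ z, ∑ t, ∑ s, f t y z s := Finset.sum_congr rfl fun _ _ => Finset.sum_congr rfl fun _ _ =>
      Finset.sum_comm
  have h4 : ∑ y, ∑ z, ∑ t, ∑ s, f t y z s = ∑ y, ∑ z, ∑ t, ∑ s, f z y t s := Finset.sum_congr rfl fun _ _ => Finset.sum_comm
  have h5 : ∑ y, ∑ z, ∑ t, ∑ s, f z y t s = ∑ y, ∑ z, ∑ t, ∑ s, f y z t s := Finset.sum_comm
  rw [h1, h2, h3, h4, h5]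

omit [DecidableEq ι] in
/-- `Σ_yΣ_zΣ_tΣ_s f(t,z,s,y) = Σ_yΣ_zΣ_tΣ_s f(y,z,t,s)` (reindexing of a quadruple site sum). [folklore] -/
theorem sum4_tzsy (f : ι → ι → ι → ι → ℝ) : ∑ y, ∑ z, ∑ t, ∑ s, f t z s y = ∑ y, ∑ z, ∑ t, ∑ s, f y z t s := by
  have h1 : ∑ y, ∑ z, ∑ t, ∑ s, f t z s y = ∑ y, ∑ z, ∑ t, ∑ s, f t y s z := Finset.sum_comm
  have h2 : ∑ y, ∑ z, ∑ t, ∑ s, f t y s z = ∑ y, ∑ z, ∑ t, ∑ s, f z y s t := Finset.sum_congr rfl fun _ _ => Finset.sum_comm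
  have h3 : ∑ y, ∑ z, ∑ t, ∑ s, f z y s t = ∑ y, ∑ z, ∑ t, ∑ s, f y z s t := Finset.sum_comm
  have h4 : ∑ y, ∑ z, ∑ t, ∑ s, f y z s t = ∑ y, ∑ z, ∑ t, ∑ s, f y z t s := Finset.sum_congr rfl fun _ _ => Finset.sum_congr rfl fun _ _ =>
      Finset.sum_comm
  rw [h1, h2, h3, h4]

/-! ## §2. The `|·|`-splits of the group values and of the assembled fifth derivative -/

omit [Fintype ι] [DecidableEq ι] in
/-- The `Cov(C,A)` group's value (four RULE-2 outputs `Cov(∂p,q) + Cov(p,∂q) − κ₃ᶜ`): twelve terms. [folklore] -/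
theorem abs_split_cov4 (a1 b1 c1 a2 b2 c2 a3 b3 c3 a4 b4 c4 : ℝ) :
    |(a1 + b1 - c1) + (a2 + b2 - c2) + (a3 + b3 - c3) + (a4 + b4 - c4)| ≤
      |a1| + |b1| + |c1| + |a2| + |b2| + |c2| + |a3| + |b3| + |c3| + |a4| + |b4| + |c4| := by
  rw [abs_le]; constructor <;> linarith [neg_abs_le a1, le_abs_self a1, neg_abs_le b1, le_abs_self b1, neg_abs_le c1, le_abs_self c1, neg_abs_le a2,
      le_abs_self a2, neg_abs_le b2, le_abs_self b2, neg_abs_le c2, le_abs_self c2, neg_abs_le a3, le_abs_self a3, neg_abs_le b3, le_abs_self b3,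
      neg_abs_le c3, le_abs_self c3, neg_abs_le a4, le_abs_self a4, neg_abs_le b4, le_abs_self b4, neg_abs_le c4, le_abs_self c4]

omit [Fintype ι] [DecidableEq ι] in
/-- The `Cov(B,B)` group's value (three RULE-2 outputs): nine terms. [folklore] -/
theorem abs_split_cov3 (a1 b1 c1 a2 b2 c2 a3 b3 c3 : ℝ) :
    |(a1 + b1 - c1) + (a2 + b2 - c2) + (a3 + b3 - c3)| ≤
      |a1| + |b1| + |c1| + |a2| + |b2| + |c2| + |a3| + |b3| + |c3| := by
  rw [abs_le]; constructor <;> linarith [neg_abs_le a1, le_abs_self a1, neg_abs_le b1, le_abs_self b1, neg_abs_le c1, le_abs_self c1, neg_abs_le a2,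
      le_abs_self a2, neg_abs_le b2, le_abs_self b2, neg_abs_le c2, le_abs_self c2, neg_abs_le a3, le_abs_self a3, neg_abs_le b3, le_abs_self b3,
      neg_abs_le c3, le_abs_self c3]

omit [Fintype ι] [DecidableEq ι] in
/-- Half the `κ₃ᶜ` group's value (three RULE-3 outputs `Σ₃κ₃ᶜ(∂·) − u₄`): twelve terms. [folklore] -/
theorem abs_split_kappa3 (a1 b1 c1 d1 a2 b2 c2 d2 a3 b3 c3 d3 : ℝ) :
    |(a1 + b1 + c1 - d1) + (a2 + b2 + c2 - d2) + (a3 + b3 + c3 - d3)| ≤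
      |a1| + |b1| + |c1| + |d1| + |a2| + |b2| + |c2| + |d2| + |a3| + |b3| + |c3| + |d3| := by
  rw [abs_le]; constructor <;> linarith [neg_abs_le a1, le_abs_self a1, neg_abs_le b1, le_abs_self b1, neg_abs_le c1, le_abs_self c1, neg_abs_le d1,
      le_abs_self d1, neg_abs_le a2, le_abs_self a2, neg_abs_le b2, le_abs_self b2, neg_abs_le c2, le_abs_self c2, neg_abs_le d2, le_abs_self d2,
      neg_abs_le a3, le_abs_self a3, neg_abs_le b3, le_abs_self b3, neg_abs_le c3, le_abs_self c3, neg_abs_le d3, le_abs_self d3]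

omit [Fintype ι] [DecidableEq ι] in
/-- The `u₄` group's value (RULE 4: `Σ₄u₄(∂·) − u₅`): five terms. [folklore] -/
theorem abs_split_u4 (a b c d f : ℝ) :
    |a + b + c + d - f| ≤
      |a| + |b| + |c| + |d| + |f| := by
  rw [abs_le]; constructor <;> linarith [neg_abs_le a, le_abs_self a, neg_abs_le b, le_abs_self b, neg_abs_le c, le_abs_self c, neg_abs_le d,
      le_abs_self d, neg_abs_le f, le_abs_self f]

omit [Fintype ι] [DecidableEq ι] in
/-- The assembled fifth derivative `G₁′ − G₂′ − G₃′ + (G₄′ + G₄″) − G₅′`: six terms. [folklore] -/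
theorem abs_split_fifth (a b c d dd f : ℝ) :
    |a - b - c + (d + dd) - f| ≤
      |a| + |b| + |c| + |d| + |dd| + |f| := by
  rw [abs_le]; constructor <;> linarith [neg_abs_le a, le_abs_self a, neg_abs_le b, le_abs_self b, neg_abs_le c, le_abs_self c, neg_abs_le d,
      le_abs_self d, neg_abs_le dd, le_abs_self dd, neg_abs_le f, le_abs_self f]

/-! ## §3. The splits summed over the row, sums distributed -/

omit [DecidableEq ι] in
/-- The mean group's value `⟨E⟩ − Cov(D,A)`, split (Mathlib's `abs_sub`) and summed over the row. [folklore] -/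
theorem sum4_abs_split_mean (a b : ι → ι → ι → ι → ℝ) :
    ∑ y, ∑ z, ∑ t, ∑ s, |a y z t s - b y z t s| ≤
      (∑ y, ∑ z, ∑ t, ∑ s, |a y z t s|) +
        (∑ y, ∑ z, ∑ t, ∑ s, |b y z t s|) := by
  calc ∑ y, ∑ z, ∑ t, ∑ s, |a y z t s - b y z t s|
      ≤ ∑ y, ∑ z, ∑ t, ∑ s, (|a y z t s| + |b y z t s|) :=
        Finset.sum_le_sum fun y _ => Finset.sum_le_sum fun z _ => Finset.sum_le_sum fun t _ => Finset.sum_le_sum fun s _ =>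
          abs_sub (a y z t s) (b y z t s)
    _ = _ := by simp only [Finset.sum_add_distrib]

omit [DecidableEq ι] in
/-- The `Cov(C,A)` group's value, split and summed over the row (twelve row sums). [folklore] -/
theorem sum4_abs_split_cov4 (a1 b1 c1 a2 b2 c2 a3 b3 c3 a4 b4 c4 : ι → ι → ι → ι → ℝ) :
    ∑ y, ∑ z, ∑ t, ∑ s, |(a1 y z t s + b1 y z t s - c1 y z t s) + (a2 y z t s + b2 y z t s - c2 y z t s) + (a3 y z t s + b3 y z t s - c3 y z t s) +
        (a4 y z t s + b4 y z t s - c4 y z t s)| ≤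
      (∑ y, ∑ z, ∑ t, ∑ s, |a1 y z t s|) +
        (∑ y, ∑ z, ∑ t, ∑ s, |b1 y z t s|) +
        (∑ y, ∑ z, ∑ t, ∑ s, |c1 y z t s|) +
        (∑ y, ∑ z, ∑ t, ∑ s, |a2 y z t s|) +
        (∑ y, ∑ z, ∑ t, ∑ s, |b2 y z t s|) +
        (∑ y, ∑ z, ∑ t, ∑ s, |c2 y z t s|) +
        (∑ y, ∑ z, ∑ t, ∑ s, |a3 y z t s|) +
        (∑ y, ∑ z, ∑ t, ∑ s, |b3 y z t s|) +
        (∑ y, ∑ z, ∑ t, ∑ s, |c3 y z t s|) +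
        (∑ y, ∑ z, ∑ t, ∑ s, |a4 y z t s|) +
        (∑ y, ∑ z, ∑ t, ∑ s, |b4 y z t s|) +
        (∑ y, ∑ z, ∑ t, ∑ s, |c4 y z t s|) := by
  calc ∑ y, ∑ z, ∑ t, ∑ s, |(a1 y z t s + b1 y z t s - c1 y z t s) + (a2 y z t s + b2 y z t s - c2 y z t s) + (a3 y z t s + b3 y z t s - c3 y z t s)
      + (a4 y z t s + b4 y z t s - c4 y z t s)|
      ≤ ∑ y, ∑ z, ∑ t, ∑ s, (|a1 y z t s| + |b1 y z t s| + |c1 y z t s| + |a2 y z t s| + |b2 y z t s| + |c2 y z t s| + |a3 y z t s| + |b3 y z t s| +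
          |c3 y z t s| + |a4 y z t s| + |b4 y z t s| + |c4 y z t s|) :=
        Finset.sum_le_sum fun y _ => Finset.sum_le_sum fun z _ => Finset.sum_le_sum fun t _ => Finset.sum_le_sum fun s _ =>
          abs_split_cov4 (a1 y z t s) (b1 y z t s) (c1 y z t s) (a2 y z t s) (b2 y z t s) (c2 y z t s) (a3 y z t s) (b3 y z t s) (c3 y z t s) (a4 y z
              t s) (b4 y z t s) (c4 y z t s)
    _ = _ := by simp only [Finset.sum_add_distrib]

omit [DecidableEq ι] in
/-- The `Cov(B,B)` group's value, split and summed over the row (nine row sums). [folklore] -/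
theorem sum4_abs_split_cov3 (a1 b1 c1 a2 b2 c2 a3 b3 c3 : ι → ι → ι → ι → ℝ) :
    ∑ y, ∑ z, ∑ t, ∑ s, |(a1 y z t s + b1 y z t s - c1 y z t s) + (a2 y z t s + b2 y z t s - c2 y z t s) + (a3 y z t s + b3 y z t s - c3 y z t s)| ≤
      (∑ y, ∑ z, ∑ t, ∑ s, |a1 y z t s|) +
        (∑ y, ∑ z, ∑ t, ∑ s, |b1 y z t s|) +
        (∑ y, ∑ z, ∑ t, ∑ s, |c1 y z t s|) +
        (∑ y, ∑ z, ∑ t, ∑ s, |a2 y z t s|) +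
        (∑ y, ∑ z, ∑ t, ∑ s, |b2 y z t s|) +
        (∑ y, ∑ z, ∑ t, ∑ s, |c2 y z t s|) +
        (∑ y, ∑ z, ∑ t, ∑ s, |a3 y z t s|) +
        (∑ y, ∑ z, ∑ t, ∑ s, |b3 y z t s|) +
        (∑ y, ∑ z, ∑ t, ∑ s, |c3 y z t s|) := by
  calc ∑ y, ∑ z, ∑ t, ∑ s, |(a1 y z t s + b1 y z t s - c1 y z t s) + (a2 y z t s + b2 y z t s - c2 y z t s) + (a3 y z t s + b3 y z t s - c3 y z t s)|
      ≤ ∑ y, ∑ z, ∑ t, ∑ s, (|a1 y z t s| + |b1 y z t s| + |c1 y z t s| + |a2 y z t s| + |b2 y z t s| + |c2 y z t s| + |a3 y z t s| + |b3 y z t s| +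
          |c3 y z t s|) :=
        Finset.sum_le_sum fun y _ => Finset.sum_le_sum fun z _ => Finset.sum_le_sum fun t _ => Finset.sum_le_sum fun s _ =>
          abs_split_cov3 (a1 y z t s) (b1 y z t s) (c1 y z t s) (a2 y z t s) (b2 y z t s) (c2 y z t s) (a3 y z t s) (b3 y z t s) (c3 y z t s)
    _ = _ := by simp only [Finset.sum_add_distrib]

omit [DecidableEq ι] in
/-- Half the `κ₃ᶜ` group's value, split and summed over the row (twelve row sums). [folklore] -/
theorem sum4_abs_split_kappa3 (a1 b1 c1 d1 a2 b2 c2 d2 a3 b3 c3 d3 : ι → ι → ι → ι → ℝ) :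
    ∑ y, ∑ z, ∑ t, ∑ s, |(a1 y z t s + b1 y z t s + c1 y z t s - d1 y z t s) + (a2 y z t s + b2 y z t s + c2 y z t s - d2 y z t s) + (a3 y z t s + b3
        y z t s + c3 y z t s - d3 y z t s)| ≤
      (∑ y, ∑ z, ∑ t, ∑ s, |a1 y z t s|) +
        (∑ y, ∑ z, ∑ t, ∑ s, |b1 y z t s|) +
        (∑ y, ∑ z, ∑ t, ∑ s, |c1 y z t s|) +
        (∑ y, ∑ z, ∑ t, ∑ s, |d1 y z t s|) +
        (∑ y, ∑ z, ∑ t, ∑ s, |a2 y z t s|) +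
        (∑ y, ∑ z, ∑ t, ∑ s, |b2 y z t s|) +
        (∑ y, ∑ z, ∑ t, ∑ s, |c2 y z t s|) +
        (∑ y, ∑ z, ∑ t, ∑ s, |d2 y z t s|) +
        (∑ y, ∑ z, ∑ t, ∑ s, |a3 y z t s|) +
        (∑ y, ∑ z, ∑ t, ∑ s, |b3 y z t s|) +
        (∑ y, ∑ z, ∑ t, ∑ s, |c3 y z t s|) +
        (∑ y, ∑ z, ∑ t, ∑ s, |d3 y z t s|) := by
  calc ∑ y, ∑ z, ∑ t, ∑ s, |(a1 y z t s + b1 y z t s + c1 y z t s - d1 y z t s) + (a2 y z t s + b2 y z t s + c2 y z t s - d2 y z t s) + (a3 y z t s +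
      b3 y z t s + c3 y z t s - d3 y z t s)|
      ≤ ∑ y, ∑ z, ∑ t, ∑ s, (|a1 y z t s| + |b1 y z t s| + |c1 y z t s| + |d1 y z t s| + |a2 y z t s| + |b2 y z t s| + |c2 y z t s| + |d2 y z t s| +
          |a3 y z t s| + |b3 y z t s| + |c3 y z t s| + |d3 y z t s|) :=
        Finset.sum_le_sum fun y _ => Finset.sum_le_sum fun z _ => Finset.sum_le_sum fun t _ => Finset.sum_le_sum fun s _ =>
          abs_split_kappa3 (a1 y z t s) (b1 y z t s) (c1 y z t s) (d1 y z t s) (a2 y z t s) (b2 y z t s) (c2 y z t s) (d2 y z t s) (a3 y z t s) (b3 y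
              z t s) (c3 y z t s) (d3 y z t s)
    _ = _ := by simp only [Finset.sum_add_distrib]

omit [DecidableEq ι] in
/-- The `u₄` group's value, split and summed over the row (five row sums). [folklore] -/
theorem sum4_abs_split_u4 (a b c d f : ι → ι → ι → ι → ℝ) :
    ∑ y, ∑ z, ∑ t, ∑ s, |a y z t s + b y z t s + c y z t s + d y z t s - f y z t s| ≤
      (∑ y, ∑ z, ∑ t, ∑ s, |a y z t s|) +
        (∑ y, ∑ z, ∑ t, ∑ s, |b y z t s|) +
        (∑ y, ∑ z, ∑ t, ∑ s, |c y z t s|) +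
        (∑ y, ∑ z, ∑ t, ∑ s, |d y z t s|) +
        (∑ y, ∑ z, ∑ t, ∑ s, |f y z t s|) := by
  calc ∑ y, ∑ z, ∑ t, ∑ s, |a y z t s + b y z t s + c y z t s + d y z t s - f y z t s|
      ≤ ∑ y, ∑ z, ∑ t, ∑ s, (|a y z t s| + |b y z t s| + |c y z t s| + |d y z t s| + |f y z t s|) :=
        Finset.sum_le_sum fun y _ => Finset.sum_le_sum fun z _ => Finset.sum_le_sum fun t _ => Finset.sum_le_sum fun s _ =>
          abs_split_u4 (a y z t s) (b y z t s) (c y z t s) (d y z t s) (f y z t s)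
    _ = _ := by simp only [Finset.sum_add_distrib]

omit [DecidableEq ι] in
/-- The assembled fifth derivative, split and summed over the row (six row sums). [folklore] -/
theorem sum4_abs_split_fifth (a b c d dd f : ι → ι → ι → ι → ℝ) :
    ∑ y, ∑ z, ∑ t, ∑ s, |a y z t s - b y z t s - c y z t s + (d y z t s + dd y z t s) - f y z t s| ≤
      (∑ y, ∑ z, ∑ t, ∑ s, |a y z t s|) +
        (∑ y, ∑ z, ∑ t, ∑ s, |b y z t s|) +
        (∑ y, ∑ z, ∑ t, ∑ s, |c y z t s|) +
        (∑ y, ∑ z, ∑ t, ∑ s, |d y z t s|) +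
        (∑ y, ∑ z, ∑ t, ∑ s, |dd y z t s|) +
        (∑ y, ∑ z, ∑ t, ∑ s, |f y z t s|) := by
  calc ∑ y, ∑ z, ∑ t, ∑ s, |a y z t s - b y z t s - c y z t s + (d y z t s + dd y z t s) - f y z t s|
      ≤ ∑ y, ∑ z, ∑ t, ∑ s, (|a y z t s| + |b y z t s| + |c y z t s| + |d y z t s| + |dd y z t s| + |f y z t s|) :=
        Finset.sum_le_sum fun y _ => Finset.sum_le_sum fun z _ => Finset.sum_le_sum fun t _ => Finset.sum_le_sum fun s _ =>
          abs_split_fifth (a y z t s) (b y z t s) (c y z t s) (d y z t s) (dd y z t s) (f y z t s)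
    _ = _ := by simp only [Finset.sum_add_distrib]

/-! ## §4. Toy -/

/-- Toy (§1 on a concrete function): reindexing does not change a quadruple sum. -/
example (f : ι → ι → ι → ι → ℝ) : ∑ y, ∑ z, ∑ t, ∑ s, f s y z t = ∑ y, ∑ z, ∑ t, ∑ s, f y z t s := sum4_syzt f

end Summit.QuantumFields.BalabanUV.T4Continuum.NE7b.SupFifthKernelSums

end
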